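import Literature.Barriers.ABC.BakerMethodBoundsKummerArchSymmProofs
import Literature.NumberTheory.Transcendental.CijsouwWaldschmidt1977Main
import HarnessLib

/-!
# `BakerMethodBounds` from the `p`-adic theory alone: the archimedean input is Cijsouw–Waldschmidt 1977

Complement to `BakerMethodBoundsKummerArchSymmProofs.lean`: its hypothesis `hW₃` (a
Kummer-conditional archimedean lower bound for linear forms in logarithms of rationals, uniform of
the shape `exp(−C(n) V₁⋯Vₙ (W + log 2Vₙ) log 2Vₙ)`) is now PROVED
(`CW77.cw77_prop1_rat_hW₃`, Cijsouw–Waldschmidt 1977, Proposition 1 over `ℚ` with `p = 2`), so that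
the Stewart–Yu 2001 bound `log c ≤ κ rad(abc)^{1/3} (log rad)³`
(`Literature.Barriers.ABC.BakerMethodBounds`) follows from Yu's `p`-adic Theorem 3.2.7 over `ℚ`
alone (`BakerMethodBounds_of_yu`), or from Evertse–Győry's Theorem 3.2.8 at the finite places
(`BakerMethodBounds_of_thm328Finite_cw77`), or from the `p`-adic clause
(`BakerMethodBounds_of_padicClause_cw77`).

## References
* C. L. Stewart, Kunrui Yu, *On the abc conjecture, II*, Duke Math. J. 108 (2001), 169–181, Theorem 1.
* P. L. Cijsouw, M. Waldschmidt, *Linear forms and simultaneous approximations*, Compositio Math.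
  34 (1977), 173–197, Proposition 1.
* J.-H. Evertse, K. Győry, *Unit Equations in Diophantine Number Theory*, Cambridge 2015, §3.2, §4.2.
-/

noncomputable section

open Finset Real Height
open Literature.NumberTheory.DiophantineGeometry
open Literature.NumberTheory.DiophantineGeometry.Dioph
open Literature.NumberTheory.DiophantineGeometry.Pasten
open Literature.NumberTheory.Transcendental.CW77

namespace Literature.Barriers.ABC

/-- **`BakerMethodBounds` from the `p`-adic clause alone** (constant `K ≥ 1`): the archimedean input
is now Cijsouw–Waldschmidt 1977, Proposition 1 over `ℚ` with `p = 2`, PROVED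
(`CW77.cw77_prop1_rat_hW₃`). [cite: StewartYu2001, Theorem 1] [cite: CijsouwWaldschmidt1977, Prop 1 (p. 183)] -/
theorem BakerMethodBounds_of_padicClause_cw77 {K : ℝ} (hK : 1 ≤ K)
    (hP2 : ∀ (ι : Type) [Fintype ι], 0 < Fintype.card ι →
      ∀ ξ : ι → ℚ, (∀ i, ξ i ≠ 0 ∧ ξ i ≠ 1 ∧ ξ i ≠ -1) →
      ∀ ζ : ℚ, (ζ = 1 ∨ ζ = -1) → ∀ b : ι → ℤ, ζ * ∏ i, ξ i ^ b i ≠ 1 →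
      ∀ p : ℕ, p.Prime →
        (padicValRat p (1 - ζ * ∏ i, ξ i ^ b i) : ℝ) * Real.log p <
          K ^ Fintype.card ι * (p / Real.log p) *
            Real.log (max (Real.exp 1) (p * logHeight₁ (ζ * ∏ i, ξ i ^ b i))) *
            ∏ i, logHeight₁ (ξ i)) :
    BakerMethodBounds :=
  BakerMethodBounds_of_padicClause_kummerArchBound₃ hK hP2 archCw archCw_nonneg cw77_prop1_rat_hW₃

/-- **`BakerMethodBounds` from Evertse–Győry's Theorem 3.2.8 over `ℚ` at the finite places alone**
(the archimedean input being Cijsouw–Waldschmidt 1977, Proposition 1 over `ℚ`, proved).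
[cite: StewartYu2001, Theorem 1] [cite: EvertseGyory2015, Thm 3.2.8 (p. 62)] [cite: CijsouwWaldschmidt1977, Prop 1 (p. 183)] -/
theorem BakerMethodBounds_of_thm328Finite_cw77
    (h328 : ∀ (ι : Type) [Fintype ι], 0 < Fintype.card ι →
      ∀ α : ι → ℚ, (∀ i, α i ≠ 0 ∧ α i ≠ 1 ∧ α i ≠ -1) →
      ∀ β : ℚ, β ≠ 0 → ∀ s : ℤ, (s = 1 ∨ s = -1) → ∀ b : ι → ℤ,
        (∏ i, α i ^ b i) * β ^ s - 1 ≠ 0 →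
      ∀ B : ℝ, (∀ i, (|b i| : ℝ) ≤ B) →
        2 * Real.exp 1 * 9 ^ (Fintype.card ι + 1) * (∏ i, logHeight₁ (α i)) *
            max (logHeight₁ β) 1 ≤ B →
        ∀ p : ℕ, p.Prime →
          -(egC6 (Fintype.card ι + 1) * (p / Real.log p) * (∏ i, logHeight₁ (α i)) *
              max (logHeight₁ β) 1 * logStar (B * p / max (logHeight₁ β) 1)) <
            -(padicValRat p ((∏ i, α i ^ b i) * β ^ s - 1) : ℝ) * Real.log p) :
    BakerMethodBounds :=
  BakerMethodBounds_of_thm328Finite_kummerArchBound₃ h328 archCw archCw_nonneg cw77_prop1_rat_hW₃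

/-- **`BakerMethodBounds` from Yu's Theorem 3.2.7 over `ℚ` alone** (the binder `hY` of
`Dioph.thm328_rat_finite_of_yu`, verbatim): the archimedean half of the Stewart–Yu bound is
Cijsouw–Waldschmidt 1977, Proposition 1 for `K = ℚ`, `p = 2`, `β₀ = 0` (Baker's method with a
`2`-descent and one Schwarz lemma per step), proved in `CW77.cw77_prop1_rat_hW₃`; only the `p`-adic
theory of linear forms in logarithms (Yu 2007) remains an input. [cite: StewartYu2001, Theorem 1]
[cite: EvertseGyory2015, Thm 3.2.7 (p. 62)] [cite: CijsouwWaldschmidt1977, Prop 1 (p. 183)] -/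
theorem BakerMethodBounds_of_yu
    (hY : ∀ (κ : Type) [Fintype κ] [DecidableEq κ], 2 ≤ Fintype.card κ →
      ∀ (α : κ → ℚ) (b : κ → ℤ) (k₀ : κ) (B Bn δ : ℝ) (p : ℕ), p.Prime →
        (∀ k, α k ≠ 0) → b k₀ ≠ 0 →
        (∀ k, b k ≠ 0 → padicValInt p (b k₀) ≤ padicValInt p (b k)) →
        (∀ k, (|b k| : ℝ) ≤ B) → Bn ≤ B → (|b k₀| : ℝ) ≤ Bn →
        ∏ k, α k ^ b k - 1 ≠ 0 → 0 < δ → δ ≤ 1 / 2 →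
        (padicValRat p (∏ k, α k ^ b k - 1) : ℝ) <
          (16 * Real.exp 1) ^ (2 * (Fintype.card κ + 1)) * (Fintype.card κ : ℝ) ^ (3 / 2 : ℝ) *
              Real.log (2 * Fintype.card κ) * Real.log 2 *
            (p / Real.log p ^ 2) *
            max ((∏ k, max (logHeight₁ (α k)) (1 / (16 * Real.exp 1 ^ 2))) *
                  Real.log (Bn * (2 * Real.exp 1 ^ ((Fintype.card κ + 1) *
                      (6 * Fintype.card κ + 5)) * Real.log 2) * (p : ℝ) ^ (Fintype.card κ + 1) *
                    (∏ k ∈ univ.erase k₀, max (logHeight₁ (α k)) (1 / (16 * Real.exp 1 ^ 2))) /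
                    δ))
              (δ * B / (Bn * (2 ^ (2 * Fintype.card κ + 1) * Real.log 2 * Real.log 3 ^ 3)))) :
    BakerMethodBounds :=
  BakerMethodBounds_of_yu_kummerArchBound₃ hY archCw archCw_nonneg cw77_prop1_rat_hW₃

/-- **`BakerMethodBounds` from a `p`-adic bound of Yu's shape with generic constants
`C₃(n) · 7(n+1)² ≤ C₆(n,1)` alone** (archimedean input: Cijsouw–Waldschmidt 1977, Prop. 1 over `ℚ`,
proved). [cite: StewartYu2001, Theorem 1] [cite: EvertseGyory2015, Thm 3.2.7 (p. 62)] [cite: CijsouwWaldschmidt1977, Prop 1 (p. 183)] -/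
theorem BakerMethodBounds_of_padicBound_cw77 (C₃ : ℕ → ℝ)
    (hC₃0 : ∀ n, 2 ≤ n → 0 ≤ C₃ n)
    (hC₃le : ∀ n, 2 ≤ n → C₃ n * (7 * ((n : ℝ) + 1) ^ 2) ≤ egC6 n)
    (hY : ∀ (κ : Type) [Fintype κ] [DecidableEq κ], 2 ≤ Fintype.card κ →
      ∀ (α : κ → ℚ) (b : κ → ℤ) (k₀ : κ) (B Bn δ : ℝ) (p : ℕ), p.Prime →
        (∀ k, α k ≠ 0) → b k₀ ≠ 0 →
        (∀ k, b k ≠ 0 → padicValInt p (b k₀) ≤ padicValInt p (b k)) →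
        (∀ k, (|b k| : ℝ) ≤ B) → Bn ≤ B → (|b k₀| : ℝ) ≤ Bn →
        ∏ k, α k ^ b k - 1 ≠ 0 → 0 < δ → δ ≤ 1 / 2 →
        (padicValRat p (∏ k, α k ^ b k - 1) : ℝ) <
          C₃ (Fintype.card κ) * (p / Real.log p ^ 2) *
            max ((∏ k, max (logHeight₁ (α k)) (1 / (16 * Real.exp 1 ^ 2))) *
                  Real.log (Bn * (2 * Real.exp 1 ^ ((Fintype.card κ + 1) *
                      (6 * Fintype.card κ + 5)) * Real.log 2) * (p : ℝ) ^ (Fintype.card κ + 1) *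
                    (∏ k ∈ univ.erase k₀, max (logHeight₁ (α k)) (1 / (16 * Real.exp 1 ^ 2))) /
                    δ))
              (δ * B / (Bn * (2 ^ (2 * Fintype.card κ + 1) * Real.log 2 * Real.log 3 ^ 3)))) :
    BakerMethodBounds :=
  BakerMethodBounds_of_padicBound_kummerArchBound₃ C₃ hC₃0 hC₃le hY archCw archCw_nonneg cw77_prop1_rat_hW₃

/-- **Stewart–Yu 2001, Theorem 1 (`Literature.NumberTheory.DiophantineGeometry.stewart_yu`) from Yu's
Theorem 3.2.7 over `ℚ` alone** (archimedean input: Cijsouw–Waldschmidt 1977, Prop. 1 over `ℚ`, proved).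
[cite: StewartYu2001, Theorem 1] [cite: CijsouwWaldschmidt1977, Prop 1 (p. 183)] -/
theorem stewart_yu_of_yu
    (hY : ∀ (κ : Type) [Fintype κ] [DecidableEq κ], 2 ≤ Fintype.card κ →
      ∀ (α : κ → ℚ) (b : κ → ℤ) (k₀ : κ) (B Bn δ : ℝ) (p : ℕ), p.Prime →
        (∀ k, α k ≠ 0) → b k₀ ≠ 0 →
        (∀ k, b k ≠ 0 → padicValInt p (b k₀) ≤ padicValInt p (b k)) →
        (∀ k, (|b k| : ℝ) ≤ B) → Bn ≤ B → (|b k₀| : ℝ) ≤ Bn →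
        ∏ k, α k ^ b k - 1 ≠ 0 → 0 < δ → δ ≤ 1 / 2 →
        (padicValRat p (∏ k, α k ^ b k - 1) : ℝ) <
          (16 * Real.exp 1) ^ (2 * (Fintype.card κ + 1)) * (Fintype.card κ : ℝ) ^ (3 / 2 : ℝ) *
              Real.log (2 * Fintype.card κ) * Real.log 2 *
            (p / Real.log p ^ 2) *
            max ((∏ k, max (logHeight₁ (α k)) (1 / (16 * Real.exp 1 ^ 2))) *
                  Real.log (Bn * (2 * Real.exp 1 ^ ((Fintype.card κ + 1) *
                      (6 * Fintype.card κ + 5)) * Real.log 2) * (p : ℝ) ^ (Fintype.card κ + 1) *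
                    (∏ k ∈ univ.erase k₀, max (logHeight₁ (α k)) (1 / (16 * Real.exp 1 ^ 2))) /
                    δ))
              (δ * B / (Bn * (2 ^ (2 * Fintype.card κ + 1) * Real.log 2 * Real.log 3 ^ 3)))) :
    Literature.NumberTheory.DiophantineGeometry.stewart_yu :=
  stewart_yu_of_yu_kummerArchBound₃ hY archCw archCw_nonneg cw77_prop1_rat_hW₃

end Literature.Barriers.ABC

end
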